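import Literature.MathematicalPhysics.QuantumLattice.SectorPropagatorDecay
import Literature.MathematicalPhysics.QuantumLattice.SectorPropagatorSum
import Mathlib.Analysis.Calculus.ParametricIntegral
import HarnessLib

/-!
# Time derivatives of the sector propagators gain `γ^h` each (BGM 2003 §7.2; BGM 2006 Lemma 2.2 with `∂₀`)

Topic `Literature/MathematicalPhysics/QuantumLattice`; continues `SectorPropagatorDecay.lean`
(Lemma 2.2 (2.52): `|g^{(h)}_ω(x)| ≤ C_N γ^{(3/2)h}(1 + …)^{-N}`). Benfatto–Giuliani–Mastropietro
2003, end of §7.2: "by using Lemma 7.3, it is easy to prove that the previous bounds have to be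
multiplied by `γ^{mh}`, if one substitutes `g^{(h)}_ω(x)` with `∂^m g^{(h)}_ω(x)/∂x₀^m`" — each time
derivative brings down a factor `-ik₀ = O(γ^h)` on the support of `f_h`. PROVED here:

* `sectorPropagatorTD m` — the propagator with the weight `(-ik₀)^m` inserted, `m = 0` being `g`;
  `hasDerivAt_sectorPropagatorTD` — `∂_{x₀}(TD m) = TD (m+1)` (differentiation under the integral),
  hence `iteratedDeriv_sectorPropagator`: `∂^m_{x₀} g^{(h)}_ω(x₀, x⃗) = TD m`;
* the weighted rescaled symbol `(-i4^{-n}t₀)^m R(t) = 4^{-nm} · 4ⁿ · (-it₀)^m Φ̂`, its `h`-uniform `C^k`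
  bounds by compactness (`exists_norm_iteratedFDeriv_rescaledTD_le`), and
* **`sectorPropagatorTD_decay`** — for all `m, N` there is `C` with
  `|∂^m_{x₀} g^{(h)}_ω(x)| ≤ C (4^{-n})^m · 4^{-n}2^{-n} · (1 + ‖(4^{-n}x₀, 4^{-n}x'₁, 2^{-n}x'₂)‖/(2π))^{-N}`
  (`= C γ^{mh} γ^{(3/2)h}(…)^{-N}`) for all `n`, all sectors and all `x`.

Everything is PROVED; the definitions are `sectorPropagatorTD`, `weightedSymbolE`, `rescaledTD`, `masterLiftTD`.

## Sources

* G. Benfatto, A. Giuliani, V. Mastropietro, Ann. Henri Poincaré 4 (2003) 137–193, §7.2 (last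
  paragraph) (arXiv:cond-mat/0207210 p. 27). [BenfattoGiulianiMastropietro2003]
* G. Benfatto, A. Giuliani, V. Mastropietro, Ann. Henri Poincaré 7 (2006) 809–898, §2.5 Lemma 2.2
  and (2.67)–(2.68) (the derived fields `∂̂`). [BenfattoGiulianiMastropietro2006]
-/

noncomputable section

open Real Set Complex Function Metric MeasureTheory Filter
open scoped Topology FourierTransform
open Literature.Analysis.Fourier

namespace Literature.MathematicalPhysics.QuantumLattice

/-! ### The propagator with time-derivative weights -/

/-- **`∂^m_{x₀}`-weighted sector propagator**: `∫ (-ik₀)^m e^{i(k⃗·x⃗ - k₀x₀)} F_{h,ω} χ/D`. [cite: BenfattoGiulianiMastropietro2003, §7.2] -/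
def sectorPropagatorTD (m : ℕ) (e₀ μ : ℝ) (n : ℕ) (ω : ℤ) (x₀ : ℝ) (x : Fin 2 → ℝ) : ℂ :=
  ∫ p : ℝ × (Fin 2 → ℝ), (-(Complex.I * (p.1 : ℂ))) ^ m * (sectorPlaneWave x₀ x p * sectorSymbol e₀ μ n ω p)

/-- `m = 0` is the propagator. [folklore] -/
theorem sectorPropagatorTD_zero (e₀ μ : ℝ) (n : ℕ) (ω : ℤ) (x₀ : ℝ) (x : Fin 2 → ℝ) :
    sectorPropagatorTD 0 e₀ μ n ω x₀ x = sectorPropagator e₀ μ n ω x₀ x := by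
  simp only [sectorPropagatorTD, pow_zero, one_mul]
  rfl

section Deriv

variable {μ : ℝ} (hμ₁ : -4 < μ) (hμ₂ : μ < -2 - Real.sqrt 2)
include hμ₁ hμ₂

omit hμ₁ hμ₂ in
/-- The time derivative of the plane wave: `∂_{x₀} e^{i(k⃗·x⃗ - k₀x₀)} = (-ik₀) e^{i(k⃗·x⃗ - k₀x₀)}`. [folklore] -/
theorem hasDerivAt_sectorPlaneWave (x : Fin 2 → ℝ) (p : ℝ × (Fin 2 → ℝ)) (x₀ : ℝ) :
    HasDerivAt (fun y : ℝ => sectorPlaneWave y x p) (-(Complex.I * (p.1 : ℂ)) * sectorPlaneWave x₀ x p) x₀ := by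
  unfold sectorPlaneWave
  have h0 : HasDerivAt (fun y : ℝ => p.2 0 * x 0 + p.2 1 * x 1 - p.1 * y) (-p.1) x₀ := by
    simpa using ((hasDerivAt_id x₀).const_mul p.1).const_sub (p.2 0 * x 0 + p.2 1 * x 1)
  have h1 : HasDerivAt (fun y : ℝ => (((p.2 0 * x 0 + p.2 1 * x 1 - p.1 * y : ℝ) : ℂ)) * Complex.I) (((-p.1 : ℝ) : ℂ) * Complex.I) x₀ :=
    h0.ofReal_comp.mul_const Complex.I
  have h2 := h1.cexp
  convert h2 using 1
  push_cast
  ring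

/-- The weighted integrand is integrable. [folklore] -/
theorem integrable_sectorWeighted {e₀ : ℝ} (he : 0 < e₀) (he' : e₀ ≤ (4 + μ) / 2) (m : ℕ) (n : ℕ) (ω : ℤ) (x₀ : ℝ) (x : Fin 2 → ℝ) :
    Integrable fun p : ℝ × (Fin 2 → ℝ) => (-(Complex.I * (p.1 : ℂ))) ^ m * (sectorPlaneWave x₀ x p * sectorSymbol e₀ μ n ω p) := by
  -- `|(-ik₀)^m| ≤ e₀^m` on the support
  have hbase := integrable_sectorPlaneWave_mul_sectorSymbol hμ₁ hμ₂ he he' n ω x₀ x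
  refine (hbase.norm.const_mul (e₀ ^ m)).mono' ?_ (ae_of_all _ fun p => ?_)
  · exact ((Complex.continuous_ofReal.comp continuous_fst).const_mul Complex.I |>.neg.pow m).aestronglyMeasurable.mul
      hbase.aestronglyMeasurable
  · by_cases hS : sectorSymbol e₀ μ n ω p = 0
    · simp [hS]
    · have h1 := (sectorSymbol_ne_zero hμ₁ hμ₂ he he' hS).1
      have hk0 : ‖-(Complex.I * (p.1 : ℂ))‖ ≤ e₀ := by
        rw [norm_neg, norm_mul, Complex.norm_I, one_mul, Complex.norm_real, Real.norm_eq_abs]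
        have h4 : (4 : ℝ) ^ (-(n : ℤ)) ≤ 1 := zpow_le_one_of_nonpos₀ (by norm_num) (by simp)
        have := abs_le.2 ⟨h1.1, h1.2⟩
        nlinarith
      rw [norm_mul, norm_pow]
      exact mul_le_mul_of_nonneg_right (pow_le_pow_left₀ (norm_nonneg _) hk0 m) (norm_nonneg _)

/-- **Differentiation under the integral**: `∂_{x₀} TD m = TD (m+1)`. [cite: BenfattoGiulianiMastropietro2003, §7.2] -/
theorem hasDerivAt_sectorPropagatorTD {e₀ : ℝ} (he : 0 < e₀) (he' : e₀ ≤ (4 + μ) / 2) (m n : ℕ) (ω : ℤ) (x₀ : ℝ) (x : Fin 2 → ℝ) :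
    HasDerivAt (fun y : ℝ => sectorPropagatorTD m e₀ μ n ω y x) (sectorPropagatorTD (m + 1) e₀ μ n ω x₀ x) x₀ := by
  have hint : ∀ y, Integrable (fun p : ℝ × (Fin 2 → ℝ) =>
      (-(Complex.I * (p.1 : ℂ))) ^ m * (sectorPlaneWave y x p * sectorSymbol e₀ μ n ω p)) :=
    fun y => integrable_sectorWeighted hμ₁ hμ₂ he he' m n ω y x
  have hint' : ∀ y, Integrable (fun p : ℝ × (Fin 2 → ℝ) =>
      (-(Complex.I * (p.1 : ℂ))) ^ (m + 1) * (sectorPlaneWave y x p * sectorSymbol e₀ μ n ω p)) :=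
    fun y => integrable_sectorWeighted hμ₁ hμ₂ he he' (m + 1) n ω y x
  have hbound : Integrable (fun p : ℝ × (Fin 2 → ℝ) => e₀ ^ (m + 1) * ‖sectorSymbol e₀ μ n ω p‖) :=
    (integrable_sectorSymbol hμ₁ hμ₂ he he' n ω).norm.const_mul _
  have hdom : ∀ᵐ p ∂(volume : Measure (ℝ × (Fin 2 → ℝ))), ∀ y ∈ (univ : Set ℝ),
      ‖(-(Complex.I * (p.1 : ℂ))) ^ (m + 1) * (sectorPlaneWave y x p * sectorSymbol e₀ μ n ω p)‖ ≤
        e₀ ^ (m + 1) * ‖sectorSymbol e₀ μ n ω p‖ := by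
    refine ae_of_all _ fun p y _ => ?_
    by_cases hS : sectorSymbol e₀ μ n ω p = 0
    · simp [hS]
    · have h1 := (sectorSymbol_ne_zero hμ₁ hμ₂ he he' hS).1
      have hk0 : ‖-(Complex.I * (p.1 : ℂ))‖ ≤ e₀ := by
        rw [norm_neg, norm_mul, Complex.norm_I, one_mul, Complex.norm_real, Real.norm_eq_abs]
        have h4 : (4 : ℝ) ^ (-(n : ℤ)) ≤ 1 := zpow_le_one_of_nonpos₀ (by norm_num) (by simp)
        have := abs_le.2 ⟨h1.1, h1.2⟩
        nlinarith
      simp only [norm_mul, norm_pow, norm_sectorPlaneWave, one_mul]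
      exact mul_le_mul_of_nonneg_right (pow_le_pow_left₀ (norm_nonneg _) hk0 _) (norm_nonneg _)
  have hderiv : ∀ᵐ p ∂(volume : Measure (ℝ × (Fin 2 → ℝ))), ∀ y ∈ (univ : Set ℝ),
      HasDerivAt (fun y => (-(Complex.I * (p.1 : ℂ))) ^ m * (sectorPlaneWave y x p * sectorSymbol e₀ μ n ω p))
        ((-(Complex.I * (p.1 : ℂ))) ^ (m + 1) * (sectorPlaneWave y x p * sectorSymbol e₀ μ n ω p)) y := by
    refine ae_of_all _ fun p y _ => ?_
    have h := ((hasDerivAt_sectorPlaneWave x p y).mul_const (sectorSymbol e₀ μ n ω p)).const_mul ((-(Complex.I * (p.1 : ℂ))) ^ m)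
    exact h.congr_deriv (by ring)
  have h := hasDerivAt_integral_of_dominated_loc_of_deriv_le (μ := (volume : Measure (ℝ × (Fin 2 → ℝ))))
    (x₀ := x₀) (s := univ) univ_mem
    (Eventually.of_forall fun y => (hint y).aestronglyMeasurable) (hint x₀) (hint' x₀).aestronglyMeasurable hdom hbound hderiv
  exact h.2

/-- **`∂^m_{x₀} g^{(h)}_ω = TD m`.** [cite: BenfattoGiulianiMastropietro2003, §7.2] -/
theorem iteratedDeriv_sectorPropagator {e₀ : ℝ} (he : 0 < e₀) (he' : e₀ ≤ (4 + μ) / 2) (m n : ℕ) (ω : ℤ) (x : Fin 2 → ℝ) :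
    iteratedDeriv m (fun y : ℝ => sectorPropagator e₀ μ n ω y x) = fun y => sectorPropagatorTD m e₀ μ n ω y x := by
  induction m with
  | zero => funext y; simp [sectorPropagatorTD_zero]
  | succ m ih =>
    rw [iteratedDeriv_succ, ih]
    funext y
    exact (hasDerivAt_sectorPropagatorTD hμ₁ hμ₂ he he' m n ω y x).deriv

end Deriv

/-! ### The weighted rescaled symbol and its `h`-uniform bounds -/

/-- The weighted symbol `(-iq₀)^m S(q)` on `ℝ³`. [folklore] -/
def weightedSymbolE (m : ℕ) (e₀ μ : ℝ) (n : ℕ) (ω : ℤ) : MomSpace → ℂ := fun q =>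
  (-(Complex.I * (q 0 : ℂ))) ^ m * sectorSymbolE e₀ μ n ω q

/-- The weighted master lift `(-it₀)^m Φ̂`. [folklore] -/
def masterLiftTD (m : ℕ) (μ e₀ : ℝ) (q : (ℝ × ℝ) × MomSpace) : ℂ := (-(Complex.I * (q.2 0 : ℂ))) ^ m * masterLift μ e₀ q

section Rescaled

variable {μ : ℝ} (hμ₁ : -4 < μ) (hμ₂ : μ < -2 - Real.sqrt 2)
include hμ₁ hμ₂

omit hμ₁ hμ₂ in
/-- **`TD m` is the Fourier transform of the weighted symbol.** [folklore] -/
theorem sectorPropagatorTD_eq_fourier (m : ℕ) (e₀ μ : ℝ) (n : ℕ) (ω : ℤ) (x₀ : ℝ) (x : Fin 2 → ℝ) :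
    sectorPropagatorTD m e₀ μ n ω x₀ x = 𝓕 (weightedSymbolE m e₀ μ n ω) (dualPoint x₀ x) := by
  rw [Real.fourier_eq', sectorPropagatorTD,
    ← measurePreserving_splitMomentum.integral_comp splitMomentum.measurableEmbedding]
  refine integral_congr_ae (ae_of_all _ fun q => ?_)
  simp only [splitMomentum_apply, weightedSymbolE, sectorSymbolE, smul_eq_mul, Matrix.cons_val_zero, Matrix.cons_val_one,
    sectorPlaneWave]
  rw [show ∀ a b c : ℂ, a * (b * c) = b * (a * c) from fun a b c => by ring]
  congr 1
  rw [inner_E3]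
  simp only [dualPoint, PiLp.toLp_apply, Matrix.cons_val_zero, Matrix.cons_val_one, Matrix.cons_val_two,
    Matrix.tail_cons, Matrix.head_cons]
  congr 1
  push_cast
  field_simp
  ring

/-- **The weighted rescaled symbol** `t ↦ weightedE(q_F + A t) = (-i4^{-n}t₀)^m R(t)`. [folklore] -/
def rescaledTD (m : ℕ) (e₀ : ℝ) (n : ℕ) (ω : ℤ) : MomSpace → ℂ := fun t =>
  (-(Complex.I * (((4 : ℝ) ^ (-(n : ℤ)) * t 0 : ℝ) : ℂ))) ^ m * rescaledSectorSymbol hμ₁ hμ₂ e₀ n ω t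

/-- The weighted symbol is the weighted rescaled symbol in the chart. [folklore] -/
theorem weightedSymbolE_eq_comp (m : ℕ) (e₀ : ℝ) (n : ℕ) (ω : ℤ) :
    weightedSymbolE m e₀ μ n ω =
      (rescaledTD hμ₁ hμ₂ m e₀ n ω ∘ (sectorChart hμ₁ hμ₂ (((ω : ℝ) + 1 / 2) * sectorWidth n) n).symm) ∘
        fun q => q + -fermiBasePoint μ (((ω : ℝ) + 1 / 2) * sectorWidth n) := by
  funext q
  have hS := congr_fun (sectorSymbolE_eq_comp hμ₁ hμ₂ e₀ n ω (μ := μ)) q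
  simp only [Function.comp_apply] at hS ⊢
  simp only [weightedSymbolE, rescaledTD]
  rw [← hS]
  congr 4
  -- the `0`-component: `(q_F + A t) 0 = 4^{-n} t 0` with `t = A⁻¹(q - q_F)`
  have h := congr_arg (fun v : MomSpace => v 0)
    ((sectorChart hμ₁ hμ₂ (((ω : ℝ) + 1 / 2) * sectorWidth n) n).apply_symm_apply
      (q + -fermiBasePoint μ (((ω : ℝ) + 1 / 2) * sectorWidth n)))
  simp only at h
  rw [sectorChart_apply] at h
  simp only [Matrix.cons_val_zero, PiLp.add_apply, PiLp.neg_apply, fermiBasePoint, neg_zero, add_zero] at h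
  exact_mod_cast h.symm

/-- `rescaledTD = 4^{-nm} · 4ⁿ • (masterLiftTD slice)`. [folklore] -/
theorem rescaledTD_eq_smul {e₀ : ℝ} (he : 0 < e₀) (he' : e₀ ≤ (4 + μ) / 2) (m n : ℕ) (ω : ℤ) :
    rescaledTD hμ₁ hμ₂ m e₀ n ω = fun t =>
      ((((4 : ℝ) ^ (-(n : ℤ))) ^ m * (4 : ℝ) ^ n : ℝ) : ℂ) •
        masterLiftTD m μ e₀ ((((ω : ℝ) + 1 / 2) * sectorWidth n, (2 : ℝ) ^ (-(n : ℤ))), t) := by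
  funext t
  rw [rescaledTD, rescaledSectorSymbol_eq_masterSymbol hμ₁ hμ₂ he he' n ω t, masterLiftTD, masterLift, smul_eq_mul]
  simp only
  push_cast
  ring

/-- The weighted lift is jointly smooth. [folklore] -/
theorem contDiff_masterLiftTD {e₀ : ℝ} (he : 0 < e₀) (m : ℕ) : ContDiff ℝ ((⊤ : ℕ∞) : WithTop ℕ∞) (masterLiftTD m μ e₀) := by
  unfold masterLiftTD
  refine ContDiff.mul ?_ (contDiff_masterLift hμ₁ hμ₂ he)
  refine ContDiff.pow ?_ m
  exact (contDiff_const.mul (Complex.ofRealCLM.contDiff.comp (contDiff_momSpace_coord 0))).neg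

/-- **`h`-uniform derivative bounds of the weighted rescaled symbols**: for all `m, k` there is `B`
with `‖D^k(rescaledTD m)(t)‖ ≤ (4^{-n})^m 4ⁿ B` for all `n`, sectors and `t`. [cite: BenfattoGiulianiMastropietro2003, §7.2] -/
theorem exists_norm_iteratedFDeriv_rescaledTD_le {e₀ : ℝ} (he : 0 < e₀) (he' : e₀ ≤ (4 + μ) / 2) (m k : ℕ) :
    ∃ B : ℝ, 0 ≤ B ∧ ∀ (n : ℕ) (ω : ℕ), ω < sectorCount n → ∀ t : MomSpace,
      ‖iteratedFDeriv ℝ k (rescaledTD hμ₁ hμ₂ m e₀ n ω) t‖ ≤ ((4 : ℝ) ^ (-(n : ℤ))) ^ m * (4 : ℝ) ^ n * B := by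
  set P : Set (ℝ × ℝ) := Icc 0 (2 * π) ×ˢ Icc 0 1 with hP
  set T : Set MomSpace := {t | |t 0| ≤ e₀ ∧ |t 1| ≤ normalExtentConst μ e₀ ∧ |t 2| ≤ tangentExtentConst μ e₀} with hT
  have hK : IsCompact (P ×ˢ T) := (isCompact_Icc.prod isCompact_Icc).prod (isCompact_momBox _ _ _)
  have hF := contDiff_masterLiftTD hμ₁ hμ₂ he m (μ := μ) (e₀ := e₀)
  have hcont : ContinuousOn (fun q : (ℝ × ℝ) × MomSpace => iteratedFDeriv ℝ k (masterLiftTD m μ e₀) q) (P ×ˢ T) :=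
    (hF.continuous_iteratedFDeriv (WithTop.coe_le_coe.2 (le_top : (k : ℕ∞) ≤ ⊤))).continuousOn
  obtain ⟨B, hB⟩ := hK.exists_bound_of_continuousOn hcont
  refine ⟨max B 0, le_max_right _ _, fun n ω hω t => ?_⟩
  set θ₀ : ℝ := ((ω : ℝ) + 1 / 2) * sectorWidth n with hθ₀
  set s : ℝ := (2 : ℝ) ^ (-(n : ℤ)) with hs
  have hc : 0 < ((4 : ℝ) ^ (-(n : ℤ))) ^ m * (4 : ℝ) ^ n := by positivity
  have hp : ((θ₀, s) : ℝ × ℝ) ∈ P := by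
    have hw := sectorWidth_pos n
    have hN := sectorCount_mul_sectorWidth n
    have hω' : (ω : ℝ) + 1 ≤ sectorCount n := by exact_mod_cast hω
    refine ⟨⟨by positivity, ?_⟩, ⟨(zpow_pos (by norm_num) _).le, zpow_le_one_of_nonpos₀ (by norm_num) (by simp)⟩⟩
    calc ((ω : ℝ) + 1 / 2) * sectorWidth n ≤ (sectorCount n : ℝ) * sectorWidth n :=
          mul_le_mul_of_nonneg_right (by linarith) hw.le
      _ = 2 * π := hN
  have heq : rescaledTD hμ₁ hμ₂ m e₀ n ω = fun t =>
      ((((4 : ℝ) ^ (-(n : ℤ))) ^ m * (4 : ℝ) ^ n : ℝ) : ℂ) • masterLiftTD m μ e₀ ((θ₀, s), t) := by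
    have := rescaledTD_eq_smul hμ₁ hμ₂ he he' m n (ω : ℤ)
    rw [Int.cast_natCast] at this
    exact this
  have hslice : ContDiff ℝ ((⊤ : ℕ∞) : WithTop ℕ∞) fun t : MomSpace => masterLiftTD m μ e₀ ((θ₀, s), t) :=
    hF.comp (contDiff_const.prodMk contDiff_id)
  have hder : iteratedFDeriv ℝ k (rescaledTD hμ₁ hμ₂ m e₀ n ω) t =
      ((((4 : ℝ) ^ (-(n : ℤ))) ^ m * (4 : ℝ) ^ n : ℝ) : ℂ) • iteratedFDeriv ℝ k (fun t : MomSpace => masterLiftTD m μ e₀ ((θ₀, s), t)) t := by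
    rw [heq]
    exact iteratedFDeriv_const_smul_apply' ((hslice.of_le (WithTop.coe_le_coe.2 (le_top : (k : ℕ∞) ≤ ⊤))).contDiffAt)
  by_cases ht : t ∈ T
  · rw [hder, norm_smul, Complex.norm_real, Real.norm_eq_abs, abs_of_pos hc]
    refine mul_le_mul_of_nonneg_left ?_ hc.le
    exact ((norm_iteratedFDeriv_slice_le hF (θ₀, s) k t).trans (hB _ (mk_mem_prod hp ht))).trans (le_max_left _ _)
  · have hsupp : tsupport (rescaledTD hμ₁ hμ₂ m e₀ n ω) ⊆ T := by
      refine (tsupport_mul_subset_right).trans ?_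
      exact closure_minimal (fun u hu => abs_le_of_rescaledSectorSymbol_ne_zero hμ₁ hμ₂ he he' hu) (isCompact_momBox _ _ _).isClosed
    have h0 : iteratedFDeriv ℝ k (rescaledTD hμ₁ hμ₂ m e₀ n ω) t = 0 := by
      by_contra hne
      exact ht (hsupp (support_iteratedFDeriv_subset k (Function.mem_support.2 hne)))
    rw [h0, norm_zero]
    positivity

/-- The weighted rescaled symbol is smooth with support in the box. [folklore] -/
theorem contDiff_rescaledTD {e₀ : ℝ} (he : 0 < e₀) (he' : e₀ ≤ (4 + μ) / 2) (m n : ℕ) (ω : ℤ) :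
    ContDiff ℝ ((⊤ : ℕ∞) : WithTop ℕ∞) (rescaledTD hμ₁ hμ₂ m e₀ n ω) ∧
      tsupport (rescaledTD hμ₁ hμ₂ m e₀ n ω) ⊆
        {t : MomSpace | |t 0| ≤ e₀ ∧ |t 1| ≤ normalExtentConst μ e₀ ∧ |t 2| ≤ tangentExtentConst μ e₀} := by
  constructor
  · rw [rescaledTD_eq_smul hμ₁ hμ₂ he he' m n ω]
    exact ((contDiff_masterLiftTD hμ₁ hμ₂ he m).comp (contDiff_const.prodMk contDiff_id)).const_smul _
  · refine (tsupport_mul_subset_right).trans ?_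
    exact closure_minimal (fun u hu => abs_le_of_rescaledSectorSymbol_ne_zero hμ₁ hμ₂ he he' hu) (isCompact_momBox _ _ _).isClosed

/-- **Decay transfer for the weighted symbol** (as in `norm_sectorPropagator_le_of_fourier_decay`). [folklore] -/
theorem norm_sectorPropagatorTD_le_of_fourier_decay {e₀ : ℝ} {m n : ℕ} {ω : ℤ} {K : ℝ} {N : ℕ}
    (hK : ∀ y, ‖𝓕 (rescaledTD hμ₁ hμ₂ m e₀ n ω) y‖ ≤ K * ((1 + ‖y‖) ^ N)⁻¹) (x₀ : ℝ) (x : Fin 2 → ℝ) :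
    ‖sectorPropagatorTD m e₀ μ n ω x₀ x‖ ≤
      ((4 : ℝ) ^ (-(n : ℤ)) * (4 : ℝ) ^ (-(n : ℤ)) * (2 : ℝ) ^ (-(n : ℤ))) *
        (K * ((1 + ‖sectorChartAdj μ (((ω : ℝ) + 1 / 2) * sectorWidth n) n (dualPoint x₀ x)‖) ^ N)⁻¹) := by
  set θ₀ : ℝ := ((ω : ℝ) + 1 / 2) * sectorWidth n with hθ₀
  set A := sectorChart hμ₁ hμ₂ θ₀ n with hA
  rw [sectorPropagatorTD_eq_fourier, weightedSymbolE_eq_comp hμ₁ hμ₂, norm_fourier_comp_add_right]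
  have h := Literature.Analysis.Fourier.norm_fourier_comp_continuousLinearEquiv_le A.symm hK (dualPoint x₀ x)
  rw [ContinuousLinearEquiv.symm_symm, adjoint_sectorChart hμ₁ hμ₂] at h
  refine h.trans (le_of_eq ?_)
  have hdet := det_sectorChart_symm hμ₁ hμ₂ θ₀ n
  rw [← hA] at hdet
  have hpos : 0 < (4 : ℝ) ^ (-(n : ℤ)) * (4 : ℝ) ^ (-(n : ℤ)) * (2 : ℝ) ^ (-(n : ℤ)) := by positivity
  have key : |(LinearMap.det ((A.symm : MomSpace ≃ₗ[ℝ] MomSpace) : MomSpace →ₗ[ℝ] MomSpace))⁻¹| =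
      (4 : ℝ) ^ (-(n : ℤ)) * (4 : ℝ) ^ (-(n : ℤ)) * (2 : ℝ) ^ (-(n : ℤ)) := by
    rw [hdet, inv_inv, abs_of_pos hpos]
  exact congrArg₂ (· * ·) key rfl

/-- **Time derivatives gain `γ^h` each** (BGM 2003 §7.2): for all `m, N` there is `C` with
`|∂^m_{x₀} g^{(h)}_ω(x₀, x⃗)| ≤ C (4^{-n})^m · 4^{-n}2^{-n} · (1 + ‖(4^{-n}x₀, 4^{-n}x'₁, 2^{-n}x'₂)‖/(2π))^{-N}`
for all `n`, all sectors `0 ≤ ω < 2^{n+1}` and all `(x₀, x⃗)`. [cite: BenfattoGiulianiMastropietro2003, §7.2] -/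
theorem sectorPropagatorTD_decay {e₀ : ℝ} (he : 0 < e₀) (he' : e₀ ≤ (4 + μ) / 2) (m N : ℕ) :
    ∃ C : ℝ, 0 ≤ C ∧ ∀ (n : ℕ) (ω : ℕ), ω < sectorCount n → ∀ (x₀ : ℝ) (x : Fin 2 → ℝ),
      ‖sectorPropagatorTD m e₀ μ n ω x₀ x‖ ≤
        C * (((4 : ℝ) ^ (-(n : ℤ))) ^ m * ((4 : ℝ) ^ (-(n : ℤ)) * (2 : ℝ) ^ (-(n : ℤ)))) *
          ((1 + ‖sectorChartAdj μ (((ω : ℝ) + 1 / 2) * sectorWidth n) n (dualPoint x₀ x)‖) ^ N)⁻¹ := by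
  choose B hB0 hB using fun k => exists_norm_iteratedFDeriv_rescaledTD_le hμ₁ hμ₂ he he' m k
  set Bs : ℝ := ∑ k ∈ Finset.range (N + 1), B k with hBs
  have hBs0 : 0 ≤ Bs := Finset.sum_nonneg fun k _ => hB0 k
  have hBle : ∀ k ≤ N, B k ≤ Bs := fun k hk =>
    Finset.single_le_sum (fun j _ => hB0 j) (Finset.mem_range.2 (Nat.lt_succ_of_le hk))
  set T : Set MomSpace := {t | |t 0| ≤ e₀ ∧ |t 1| ≤ normalExtentConst μ e₀ ∧ |t 2| ≤ tangentExtentConst μ e₀} with hT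
  have hTc : IsCompact T := isCompact_momBox _ _ _
  have hTfin : volume T < ⊤ := hTc.measure_lt_top
  set vol : ℝ := (volume T).toReal with hvol
  refine ⟨2 ^ N * (Bs * vol), by positivity, fun n ω hω x₀ x => ?_⟩
  set f := rescaledTD hμ₁ hμ₂ m e₀ n (ω : ℤ) with hf
  obtain ⟨hfc, hsub⟩ := contDiff_rescaledTD hμ₁ hμ₂ he he' m n (ω : ℤ)
  rw [← hf] at hfc hsub
  have hsupp : HasCompactSupport f := hTc.of_isClosed_subset (isClosed_tsupport _) hsub
  have hc : 0 ≤ ((4 : ℝ) ^ (-(n : ℤ))) ^ m * (4 : ℝ) ^ n := by positivity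
  have hM : ∀ k ≤ N, ∀ t, ‖iteratedFDeriv ℝ k f t‖ ≤ ((4 : ℝ) ^ (-(n : ℤ))) ^ m * (4 : ℝ) ^ n * Bs := fun k hk t =>
    (hB k n ω hω t).trans (mul_le_mul_of_nonneg_left (hBle k hk) hc)
  have hvolle : (volume (tsupport f)).toReal ≤ vol := ENNReal.toReal_mono hTfin.ne (measure_mono hsub)
  have hK : ∀ y, ‖𝓕 f y‖ ≤ 2 ^ N * (((4 : ℝ) ^ (-(n : ℤ))) ^ m * (4 : ℝ) ^ n * Bs * vol) * ((1 + ‖y‖) ^ N)⁻¹ := fun y =>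
    norm_fourier_le_of_iteratedFDeriv_le hfc hsupp hM hvolle y
  have h := norm_sectorPropagatorTD_le_of_fourier_decay hμ₁ hμ₂ hK x₀ x
  push_cast at h ⊢
  refine h.trans (le_of_eq ?_)
  have h44 : (4 : ℝ) ^ (-(n : ℤ)) * (4 : ℝ) ^ n = 1 := by
    rw [zpow_neg, zpow_natCast, inv_mul_cancel₀ (by positivity)]
  linear_combination (2 ^ N * Bs * vol * ((4 : ℝ) ^ (-(n : ℤ))) ^ m * (4 : ℝ) ^ (-(n : ℤ)) * (2 : ℝ) ^ (-(n : ℤ)) *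
    ((1 + ‖sectorChartAdj μ (((ω : ℝ) + 1 / 2) * sectorWidth n) n (dualPoint x₀ x)‖) ^ N)⁻¹) * h44

end Rescaled

end Literature.MathematicalPhysics.QuantumLattice

end
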